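import Summits.HodgeConjecture.CorCM.HypLiu418.A3Liu418EpsRigidFaceTypes
import Literature.NumberTheory.Automorphic.Liu2021.Thm418CyclotomicUnitIsLocalNormDyadic
import Literature.NumberTheory.QuadraticForms.HilbertSymbolNormCompatAtTwoCompletion
import HarnessLib

/-!
# Row III-11c `CyclotomicUnitIsLocalNormDyadic` modulo the projection formula at `2` (cell `hodgecm-mathlib`, III-11 road P6)

The binder `Summit.HodgeConjecture.CorCM.Lines.A3Liu418.CyclotomicUnitIsLocalNormDyadic` of A-p19's III-11 face types
(`A3Liu418EpsRigidFaceTypes`, p611602) — «for `μ` conjugate symplectic (of weight one), `σ ∈ Aut(ℂ/M_μ)`, a (non-split)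
place `v ∣ 2` of `F⁺` and `κ ∈ F⁺_v` with `σ ∘ ψ_v = ψ_v(κ ·)`, the unit `κ` is a norm from the place model
`F ⊗_{F⁺} F⁺_v`» — follows from the tree theorems
`Literature.NumberTheory.Automorphic.Liu2021.exists_mul_conjLocal_eq_of_adeleAddCharAt_galoisTwist_of_localNormCompat` /
`…_of_normCompatAtTwo` (`Liu2021/Thm418CyclotomicUnitIsLocalNormDyadic`, over `Thm418CyclotomicUnitsLocalNormsDyadic` =
[Liu2021] Thm. 4.18 (3) proof l. 2279–2289, PROVED from the tree's L2/L3, Serre's `2`-adic symbols and O'Meara 63:16)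
CONDITIONALLY on the projection formula `(a, b)_K = (a, N_{K/ℚ₂} b)_{ℚ₂}` of local class field theory ([NeukirchANT1999]
IV (6.4), V (3.1)–(3.2)), in two currencies:

* `cyclotomicUnitIsLocalNormDyadic_of_localNormCompat` — hypothesis = the projection formula for the COMPLETIONS OF NUMBER
  FIELDS at their dyadic places with the canonical `ℚ₂`-structure (`LocalField.adicCompletionPadicAlgebra`), stated exactly
  as the cell's LCFT-free discharge `hilbertSymbol_normCompat_adicCompletion_two` (A-p13, «III-11c global road»: Hilbert
  reciprocity + approximation) will supply it — so that `cyclotomicUnitIsLocalNormDyadic_holds` is one application away;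
* `cyclotomicUnitIsLocalNormDyadic_of_normCompatAtTwo` — hypothesis = the named fact
  `Literature.NumberTheory.QuadraticForms.HilbertSymbolNormCompatAtTwo` (abstract `K/ℚ₂` finite; cell `bsd`'s fact, nothing
  asserted here).

* `cyclotomicUnitIsLocalNormDyadic_holds` (APPEND, A-p11 g4) — **row III-11c CLOSED OUTRIGHT**: the first currency fed by the
  tree theorem `Literature.NumberTheory.QuadraticForms.hilbertSymbol_normCompat_adicCompletion_two` (A-p13, «III-11c global
  road»: the projection formula for completions of number fields at `2` from Hilbert reciprocity over `F` and over `ℚ`,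
  the odd-place norm identity, square-class approximation and the `2`-adic square classes — no local class field theory).

Theorems only, no definition, no named fact of its own; the weight-one and non-split hypotheses are absorbed.  HC_CM is proved
only modulo the 7 printed citations until rung 0 closes.
-/

open scoped NumberField

namespace Summit.HodgeConjecture.CorCM.HypLiu418

open NumberField IsDedekindDomain Literature.NumberTheory.QuadraticForms

/-- **Row III-11c modulo the projection formula for completions of number fields at `2`**: if
`(a, b)_𝔭 = (a, N_{K_𝔭/ℚ₂} b)_{ℚ₂}` for every number field `K`, every place `𝔭 ∣ 2` of `K` (canonical `ℚ₂`-structure on `K_𝔭`),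
`a ∈ ℚ₂ˣ`, `b ∈ K_𝔭ˣ`, then `CyclotomicUnitIsLocalNormDyadic` holds ([Liu2021] Thm. 4.18 (3), proof l. 2279–2289; tree
`Liu2021.exists_mul_conjLocal_eq_of_adeleAddCharAt_galoisTwist_of_localNormCompat`).
[cite: Liu2021, Thm. 4.18 (3), proof l. 2279–2289] -/
theorem cyclotomicUnitIsLocalNormDyadic_of_localNormCompat
    (hP : ∀ (K : Type) [Field K] [NumberField K] (𝔭 : HeightOneSpectrum (𝓞 K)) (h2 : ((2 : ℕ) : 𝓞 K) ∈ 𝔭.asIdeal)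
      {a : ℚ_[2]}, a ≠ 0 → ∀ {b : 𝔭.adicCompletion K}, b ≠ 0 →
        letI := Literature.NumberTheory.GaloisRepresentations.LocalField.adicCompletionPadicAlgebra 𝔭 2 h2
        hilbertSymbol (𝔭.adicCompletion K) (algebraMap ℚ_[2] (𝔭.adicCompletion K) a) b =
          hilbertSymbol ℚ_[2] a (Algebra.norm ℚ_[2] b)) :
    Summit.HodgeConjecture.CorCM.Lines.A3Liu418.CyclotomicUnitIsLocalNormDyadic :=
  fun F _μ hμ _ σ hσ v h2 _ κ hκ =>
    Literature.NumberTheory.Automorphic.Liu2021.exists_mul_conjLocal_eq_of_adeleAddCharAt_galoisTwist_of_localNormCompat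
      (L := (F : Type)) hμ σ hσ v (by exact_mod_cast h2) (fun _ _ ha hb => hP _ v (by exact_mod_cast h2) ha hb) κ hκ

/-- **Row III-11c modulo the named fact `HilbertSymbolNormCompatAtTwo`** (projection formula for every finite `K/ℚ₂`):
`HilbertSymbolNormCompatAtTwo → CyclotomicUnitIsLocalNormDyadic` ([Liu2021] Thm. 4.18 (3), proof l. 2279–2289; tree
`Liu2021.exists_mul_conjLocal_eq_of_adeleAddCharAt_galoisTwist_of_normCompatAtTwo`).
[cite: Liu2021, Thm. 4.18 (3), proof l. 2279–2289] -/
theorem cyclotomicUnitIsLocalNormDyadic_of_normCompatAtTwo (h : HilbertSymbolNormCompatAtTwo) :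
    Summit.HodgeConjecture.CorCM.Lines.A3Liu418.CyclotomicUnitIsLocalNormDyadic :=
  fun F _μ hμ _ σ hσ v h2 _ κ hκ =>
    Literature.NumberTheory.Automorphic.Liu2021.exists_mul_conjLocal_eq_of_adeleAddCharAt_galoisTwist_of_normCompatAtTwo
      (L := (F : Type)) h hμ σ hσ v h2 κ hκ

/-- **Row III-11c `CyclotomicUnitIsLocalNormDyadic` — CLOSED OUTRIGHT (no hypothesis)**: for `μ` conjugate symplectic,
`σ ∈ Aut(ℂ/M_μ)`, a place `v ∣ 2` of `F⁺` and `κ ∈ F⁺_v` with `σ ∘ ψ_v = ψ_v(κ ·)`, the unit `κ` is a norm from the place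
model `F ⊗_{F⁺} F⁺_v` ([Liu2021] Thm. 4.18 (3), proof l. 2279–2289).  The projection formula
`(a, b)_{F_𝔭} = (a, N_{F_𝔭/ℚ₂} b)_{ℚ₂}` required by `cyclotomicUnitIsLocalNormDyadic_of_localNormCompat` is the tree theorem
`Literature.NumberTheory.QuadraticForms.hilbertSymbol_normCompat_adicCompletion_two` (global road: Hilbert reciprocity,
[Omeara1963] §71 Thm. 71:18, §63B; statement [NeukirchANT1999] IV (6.4), V (3.1)–(3.2)).  This is the by-name filler of
`stub_cyclotomicUnitIsLocalNormDyadic` in the `a3_liu418` skeleton and of the binder `hN₂` of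
`Lines.A3Liu418.epsRigidAtFace_of_localTwist`.
[cite: Liu2021, Thm. 4.18 (3), proof l. 2279–2289] -/
theorem cyclotomicUnitIsLocalNormDyadic_holds :
    Summit.HodgeConjecture.CorCM.Lines.A3Liu418.CyclotomicUnitIsLocalNormDyadic :=
  cyclotomicUnitIsLocalNormDyadic_of_localNormCompat
    fun K _ _ 𝔭 h2 _ ha _ hb => hilbertSymbol_normCompat_adicCompletion_two K 𝔭 h2 ha hb

end Summit.HodgeConjecture.CorCM.HypLiu418
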